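import Literature.NumberTheory.Automorphic.GL2AdelicWeightVectors
import Literature.NumberTheory.Automorphic.NewformAdelisationHeckeOperator
import HarnessLib

/-!
# The adelic lift of a modular form at every point of `GL₂(𝔸_ℚ)`: archimedean slices, weight `k`,
# and the first-order identities `Z φ_f = 0`, `W φ_f = ik φ_f`

Topic `NumberTheory/Automorphic`; theorems only (no definition, no named fact; D-0026). A brick of
the dictionary "holomorphic eigenform `f` of weight `k` ↦ the automorphic representation of
`GL₂(𝔸_ℚ)` generated by its adelic lift `φ_f`" in the direction `f ↦ π` (Gelbart 1975, §3,
Prop. 3.1; Gelbart 1997, Prop. 2.5, (2.5.4) (iii)–(iv); Bump 1997, §3.6), which the tree has so far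
only in the direction `π ↦ f` (`StrongArtinGL2WeightOneDictionary`, `GL2AdelicWeightVectors`) and,
for `f ↦ π`, at the identity finite component (`hasArchWeight_adelicLiftFun`). Here the archimedean
structure of `φ_f = adelicLiftFun N k f` is read at EVERY adelic point, along
`ι_𝔸 : GL₂(ℝ) → GL₂(𝔸_ℚ)`, `g ↦ (g, 1)` (`Rat.ofRealGLA`, `Rat.iotaA`):

* `exists_archSlice_adelicLiftFun` — **slices**: for every `a ∈ GL₂(𝔸_ℚ)` there is
  `h_∞ ∈ GL₂(ℝ)⁺` with `φ_f(a · ι_𝔸(x)) = archLift k f (h_∞ x)` for all `x ∈ GL₂(ℝ)⁺` (write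
  `a = γ h`, `γ ∈ GL₂(ℚ)`, `h ∈ GL₂(ℝ)⁺ × K₁(N)`, `Rat.exists_ofGlobal_inv_mul_mem_plusLevelOne`);
* `adelicLiftFun_mul_ofRealGLA_of_smul_I` — **weight `k` at every point** (Gelbart's (iii)–(iv)):
  `φ_f(a · ι_𝔸(κ)) = φ_f(a) j(κ, i)^{-k} (√det κ)^k` for `κ ∈ GL₂(ℝ)⁺` fixing `i`; in particular
  `adelicLiftFun_mul_ofRealGLA_realScalarGL` (invariance under `ℝ_{>0}`) and
  `adelicLiftFun_mul_ofRealGLA_rotGL` (`φ_f(a · ι_𝔸(r(θ))) = φ_f(a) e^{-ikθ}`);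
* `isWeightVec_adelicLiftFunA` — `φ_f` is a vector of `SO(2)`-weight `k` along `ι_𝔸`
  (`GL2Real.IsWeightVec`, `k_θ = r(-θ)`);
* `lieDeriv_rotGen_adelicLiftFunA` — **`W φ_f = ik φ_f`**; `lieDeriv_one_adelicLiftFunA` —
  **`Z φ_f = 0`** (`Z = 1 ∈ 𝔤𝔩₂(ℝ)`), both along `ι_𝔸` at every point.

These are the first-order inputs of the Casimir computation `C φ_f = ((k-1)²/2 - ½) φ_f`
(second-order, with the lowering operator; separate brick) feeding
`Rat.isZFinite_of_casimir_of_zed` and `GL2Casimir.hasHCParameter_of_sum_rho_single_of_rho_one`.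

## References

* S. Gelbart, *Automorphic forms on adele groups*, Ann. of Math. Stud. 83 (1975), §3, (3.4),
  Prop. 3.1 (iii), (v). [Gelbart1975]
* S. Gelbart, *Three lectures on the modularity of `ρ̄_{E,3}` …* (1997), Prop. 2.5, (2.5.4). [Gelbart1997]
* D. Bump, *Automorphic Forms and Representations* (1997), §2.1 (weights), §3.6 (adelisation). [Bump1997]
-/

noncomputable section

open scoped MatrixGroups Matrix
open NumberField UpperHalfPlane

namespace Literature.NumberTheory.Automorphic

-- Mathlib idiom (Mathlib/Algebra/Lie/OfAssociative.lean), as in `GL2WeightVectors`: Lie subalgebras of matrix algebras.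
attribute [local instance 100] LieRing.ofAssociativeRing

open GL2Real

variable {N : ℕ} [NeZero N] {k : ℤ} {F : Type*} [FunLike F ℍ ℂ]
  [SlashInvariantFormClass F (CongruenceSubgroup.Gamma1 N) k] (f : F)

/-! ### Archimedean slices of the adelic lift -/

/-- **Archimedean slices of `φ_f`.** For every `a ∈ GL₂(𝔸_ℚ)` there is `h_∞ ∈ GL₂(ℝ)⁺` such that
`φ_f(a · (x, 1)) = archLift k f (h_∞ x)` for every `x ∈ GL₂(ℝ)⁺`: write `a = γ h` with `γ ∈ GL₂(ℚ)`,
`h ∈ GL₂(ℝ)⁺ × K₁(N)` (`Rat.exists_ofGlobal_inv_mul_mem_plusLevelOne`); then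
`γ⁻¹ (a (x, 1)) = h (x, 1) ∈ GL₂(ℝ)⁺ × K₁(N)` and `φ_f(a (x,1)) = archLift k f ((h (x,1))_∞)
= archLift k f (h_∞ x)` (`adelicLiftFun_eq_archLift`). Gelbart 1975, (3.4)–(3.5).
[cite: Gelbart1975, (3.4)] -/
theorem exists_archSlice_adelicLiftFun (a : GL (Fin 2) (AdeleRing (𝓞 ℚ) ℚ)) :
    ∃ h₀ : GL (Fin 2) ℝ, 0 < h₀.det.val ∧
      ∀ x : GL (Fin 2) ℝ, 0 < x.det.val →
        adelicLiftFun N k f (a * Rat.ofRealGL 2 x) = archLift k f (h₀ * x) := by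
  obtain ⟨γ, hγ⟩ := Rat.exists_ofGlobal_inv_mul_mem_plusLevelOne (Ideal.span {(N : 𝓞 ℚ)}) a
  obtain ⟨hdet, hfin⟩ := Rat.mem_plusLevelOne_iff.1 hγ
  refine ⟨Rat.archGL 2 ((GLn.ofGlobal 2 ℚ γ)⁻¹ * a), hdet, fun x hx ↦ ?_⟩
  have hmem : (GLn.ofGlobal 2 ℚ γ)⁻¹ * (a * Rat.ofRealGL 2 x) ∈ Rat.plusLevelOne (Ideal.span {(N : 𝓞 ℚ)}) := by
    rw [Rat.mem_plusLevelOne_iff, ← mul_assoc, map_mul (Rat.archGL 2), Rat.archGL_ofRealGL,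
      map_mul (GLn.sndHom 2 ℚ), Rat.sndHom_ofRealGL, mul_one, map_mul, Units.val_mul]
    exact ⟨mul_pos hdet hx, hfin⟩
  rw [adelicLiftFun_eq_archLift f hmem, ← mul_assoc, map_mul, Rat.archGL_ofRealGL]

/-! ### Weight `k` at every adelic point -/

/-- **Weight `k` of `φ_f` at every point of `GL₂(𝔸_ℚ)`** (Gelbart's conditions (iii)–(iv) read
adelically): for `κ ∈ GL₂(ℝ)⁺` fixing `i`,
`φ_f(a · (κ, 1)) = φ_f(a) · j(κ, i)^{-k} (√det κ)^k`. Proof: on the slice through `a`,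
`φ_f(a (κ,1)) = archLift k f (h_∞ κ)` and `φ_f(a) = archLift k f (h_∞)`, and `archLift k f` has weight
`k` (`hasArchWeight_archLift`). Gelbart 1975, Prop. 3.1 (iii), (v); Gelbart 1997, (2.5.4) (iii)–(iv).
[cite: Gelbart1975, Prop. 3.1] [cite: Gelbart1997, (2.5.4) (iii)–(iv)] -/
theorem adelicLiftFun_mul_ofRealGLA_of_smul_I (a : GL (Fin 2) (AdeleRing (𝓞 ℚ) ℚ))
    {κ : GL (Fin 2) ℝ} (hκ : 0 < κ.det.val) (hκI : κ • UpperHalfPlane.I = UpperHalfPlane.I) :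
    adelicLiftFun N k f (a * Rat.ofRealGL 2 κ) =
      adelicLiftFun N k f a * (denom κ UpperHalfPlane.I ^ (-k) * ((Real.sqrt κ.det.val : ℝ) : ℂ) ^ k) := by
  obtain ⟨h, hh, hslice⟩ := exists_archSlice_adelicLiftFun f a
  have h1 : adelicLiftFun N k f a = archLift k f h := by
    have := hslice 1 (by rw [map_one, Units.val_one]; exact one_pos)
    rwa [map_one, mul_one, mul_one] at this
  rw [hslice κ hκ, h1]
  exact hasArchWeight_archLift k f h κ hh hκ hκI

/-- **`φ_f` is invariant under the positive real scalars at `∞`**, at every adelic point: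
`φ_f(a · (r·1, 1)) = φ_f(a)`, `r > 0` (condition (iv), central character trivial on `ℝ_{>0}`).
[cite: Gelbart1997, (2.5.4) (iv)] -/
theorem adelicLiftFun_mul_ofRealGLA_realScalarGL (a : GL (Fin 2) (AdeleRing (𝓞 ℚ) ℚ))
    {r : ℝ} (hr : 0 < r) :
    adelicLiftFun N k f (a * Rat.ofRealGL 2 (realScalarGL r hr)) = adelicLiftFun N k f a := by
  obtain ⟨h, hh, hslice⟩ := exists_archSlice_adelicLiftFun f a
  have h1 : adelicLiftFun N k f a = archLift k f h := by
    have := hslice 1 (by rw [map_one, Units.val_one]; exact one_pos)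
    rwa [map_one, mul_one, mul_one] at this
  have hdet : 0 < (realScalarGL r hr).det.val := by rw [det_realScalarGL]; positivity
  rw [hslice _ hdet, h1]
  exact (hasArchWeight_archLift k f).mul_realScalarGL hh hr

/-- **Condition (iii) at every adelic point**: `φ_f(a · (r(θ), 1)) = φ_f(a) e^{-ikθ}`
(`HasArchWeight.mul_rotGL` on the slice). [cite: Gelbart1997, (2.5.4) (iii)] -/
theorem adelicLiftFun_mul_ofRealGLA_rotGL (a : GL (Fin 2) (AdeleRing (𝓞 ℚ) ℚ)) (θ : ℝ) :
    adelicLiftFun N k f (a * Rat.ofRealGL 2 (rotGL θ)) =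
      adelicLiftFun N k f a * Complex.exp (θ * Complex.I) ^ (-k) := by
  obtain ⟨h, hh, hslice⟩ := exists_archSlice_adelicLiftFun f a
  have h1 : adelicLiftFun N k f a = archLift k f h := by
    have := hslice 1 (by rw [map_one, Units.val_one]; exact one_pos)
    rwa [map_one, mul_one, mul_one] at this
  rw [hslice _ (det_rotGL_pos θ), h1]
  exact (hasArchWeight_archLift k f).mul_rotGL hh θ

set_option maxHeartbeats 800000 in
/-- **`φ_f` has `SO(2)`-weight `k` along `ι_𝔸`**: `φ_f(a · ι_𝔸(k_θ)) = e^{ikθ} φ_f(a)` for all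
`a ∈ GL₂(𝔸_ℚ)` and `θ` (`k_θ = r(-θ)`, `GL2Real.rotK`; `GL2Real.IsWeightVec`). Gelbart 1997,
(2.5.4) (iii); Bump 1997, §2.1 ((2.1): weight `k`). [cite: Gelbart1997, (2.5.4) (iii)] [cite: Bump1997, §2.1] -/
theorem isWeightVec_adelicLiftFunA : IsWeightVec Rat.iotaA k (adelicLiftFunA N k f) := by
  intro θ a
  change adelicLiftFun N k f ((show GL (Fin 2) (AdeleRing (𝓞 ℚ) ℚ) from a) * Rat.ofRealGL 2 (rotGL (-θ))) =
    Complex.exp (k * θ * Complex.I) * adelicLiftFun N k f (show GL (Fin 2) (AdeleRing (𝓞 ℚ) ℚ) from a)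
  rw [adelicLiftFun_mul_ofRealGLA_rotGL f _ (-θ), mul_comm]
  congr 1
  rw [← Complex.exp_int_mul]
  congr 1
  push_cast
  ring

/-! ### First-order identities along `ι_𝔸`: `W φ_f = ik φ_f`, `Z φ_f = 0` -/

/-- **`W φ_f = ik φ_f` along `ι_𝔸`** at every point of `GL₂(𝔸_ℚ)` (`W = E₁₂ - E₂₁ = rotGen`
generates `SO(2)`; `GL2Real.IsWeightVec.lieDeriv_rotGen`). Bump 1997, (2.33)–(2.36).
[cite: Bump1997, (2.33)–(2.36)] -/
theorem lieDeriv_rotGen_adelicLiftFunA :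
    lieDeriv Rat.iotaA (toLie rotGen) (adelicLiftFunA N k f) = (Complex.I * k) • adelicLiftFunA N k f :=
  (isWeightVec_adelicLiftFunA f).lieDeriv_rotGen

set_option maxHeartbeats 800000 in
/-- **`Z φ_f = 0` along `ι_𝔸`** at every point of `GL₂(𝔸_ℚ)` (`Z = 1 ∈ 𝔤𝔩₂(ℝ)`;
`exp(tZ) = e^t · 1` and `φ_f` is invariant under the positive scalars at `∞`). Gelbart 1997,
(2.5.4) (iv). [cite: Gelbart1997, (2.5.4) (iv)] -/
theorem lieDeriv_one_adelicLiftFunA :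
    lieDeriv Rat.iotaA (toLie 1) (adelicLiftFunA N k f) = 0 := by
  funext a
  have h : (fun t : ℝ => adelicLiftFunA N k f
      (a * Rat.iotaA ((RealMatrixGroup.gl ℝ (Fin 2)).expMem (t • toLie 1)))) = fun _ => adelicLiftFunA N k f a := by
    funext t
    change adelicLiftFun N k f ((show GL (Fin 2) (AdeleRing (𝓞 ℚ) ℚ) from a) *
        Rat.ofRealGL 2 (expGL (t • (1 : Matrix (Fin 2) (Fin 2) ℝ)))) =
      adelicLiftFun N k f (show GL (Fin 2) (AdeleRing (𝓞 ℚ) ℚ) from a)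
    rw [expGL_smul_one, adelicLiftFun_mul_ofRealGLA_realScalarGL]
  change deriv (fun t : ℝ => adelicLiftFunA N k f
      (a * Rat.iotaA ((RealMatrixGroup.gl ℝ (Fin 2)).expMem (t • toLie 1)))) 0 = 0
  rw [h, deriv_const]

end Literature.NumberTheory.Automorphic
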